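/-
COR-CM (cell pub-hodgecm2, stage 2 of the Hodge ladder) — lane V-TRANSPORT, closing stone (seat b06 gen 23; count-neutral: no BINDER-OWNERS row,
no E term, no display of record; `Interfaces.lean` (C1), `Assembly/*`, `B01/*`, `Transposition/*`, `StubTree/*` untouched; wording of record
untouched).  THE QUANTIFIER COLLAPSE flagged as «not claimed here» in `CorCM/FacePeriodWitnesses.lean` (docstring of
`exists_facePeriod_of_perLFace`): on the universe of record the `∀ ι₁ ∀ V`-form `PerLFace(U) = PeriodThmF(U)` and the `∃`-forms consumed by
`hc_cm_closed_of_exists_facePeriod` (:189), `hc_cm_closed_of_exists_facePeriod_free` (`Transposition/AssemblyFree.lean`:191) and the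
same-field case of `hc_cm_closed_of_exists_foreignFacePeriod_upToTwistAndSquare` (`FacePeriodsForeignOrbit.lean`) are EQUIVALENT, face by
face.  Rows used (all tree theorems): A `Model.periodNV_transport` (TowerTransport, b06), B `Model.periodNV_relabel` (TowerRelabel, b06),
C `Model.periodNV_of_periodNV_of_forall_mem` (PeriodCharacterTransport, b07), T `Model.periodNV_twist` (CMTwistSemilinear, idea-1 / b06),
the square symmetries `Model.periodNV_iff_of_sameSquare` (FaceSquareSymmetry, b07), and «two complex embeddings of a Galois field differ by an
automorphism» (`Literature.AlgebraicGeometry.Pohlmann1968.exists_algEquiv_comp_eq`).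
Wording of record (verbatim, unchanged by this file): HC_CM follows in the kernel from BallQuotientUniformised ∧ PerLFace(model universe of record).
T5: consistency check by b06 g23 2026-08-21 — BY INHABITATION: the only named-fact hypothesis binders of the new theorems are the four
universe-of-record records `exists_isReal_hodgeModel` / `hodgePQ_independent_of_hodgeModel` / `BallQuotientUniformised` / `CMAbelianVarietyRealised`,
all DISCHARGED tree theorems (`exists_isReal_hodgeModel_holds`, `hodgePQ_independent_of_hodgeModel_holds`, `BallQuotient.ballQuotientUniformised_holds`,
`cmAbelianVarietyRealised_holds`), so their conjunction is inhabited and no contradiction is derivable; the remaining binders are data and elementary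
side conditions (`IsGalois ℚ F`, `2 < finrank ℚ F` / `6 ≤ finrank ℚ F`, admissibility, a `PeriodNV` ANTECEDENT of the same open kind as the
conclusion — transports, no supply hypothesis, no hand-summarised Literature binder) — no contradiction derived.  HC_CM is NOT proved.
-/
import Summits.HodgeConjecture.CorCM.FacePeriodOrbit
import Summits.HodgeConjecture.CorCM.FacePeriodWitnesses
import Summits.HodgeConjecture.CorCM.Geometry.NonVacuity
import Summits.HodgeConjecture.CorCM.Proofs.Landherr
import Literature.AlgebraicGeometry.Pohlmann1968.CMTypeRankCharactersNumberField
import HarnessLib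

/-!
# COR-CM — the quantifier collapse: `PerLFace(U)` ⇔ one free face-period datum per face (universe of record)

Let `U = Model.picardCMUniverse hHD hI h₁ h₃` and let `F` be a Galois CM field.  A **free face-period datum** for a face `f` of `F` is
ANY `(ι₀, V₀, σ)` — a complex embedding `ι₀` of `F` (NOT necessarily admissible for `f`), a hermitian 3-space `V₀` over `(F, ι₀)` and an
eigen-embedding `σ` — with `U.PeriodNV ι₀ V₀ F f.psi σ`.

* **`Model.periodNV_collapse`** — for `[F:ℚ] > 2`: ONE free datum for `f` gives `U.PeriodNV ι₁ V F f.psi ι₁` for EVERY admissible `ι₁`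
  and EVERY `V : HermSpace3 F ι₁` (row C moves `σ ↦ ι₁`; `ι₁ = ι₀ ∘ γ` for some `γ ∈ Aut F` since `F/ℚ` is normal; row B relabels the
  tower along `γ` and spreads over every `V`).
* **`Model.exists_facePeriod_free_iff_forall`**, **`Model.exists_facePeriod_iff_forall`** — per face, for `[F:ℚ] ≥ 6`: the free (resp.
  admissible) `∃`-form ⇔ the `∀ ι₁ ∀ V`-form.
* **`Model.perLFace_iff_exists_facePeriod`** — `U.PerLFace` ⇔ the LITERAL hypothesis of `hc_cm_closed_of_exists_facePeriod`
  (`FacePeriodWitnesses.lean`:189; the re-typed stage-2 crux «FacePeriodExists» of hodge-director/WEEKEND-PLAN.md §0);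
  **`Model.perLFace_iff_exists_facePeriod_free`** — ⇔ the literal hypothesis of `hc_cm_closed_of_exists_facePeriod_free`.
* **`Model.periodNV_of_sameSquare_twist`**, **`Model.perLFace_iff_exists_facePeriod_upToTwistSquare`** — ⇔ one free datum per class of
  faces under Galois twists `f ↦ f.twist g` and the square symmetries (same unordered places, base type a corner), i.e. the SAME-FIELD case
  of the hypothesis of `hc_cm_closed_of_exists_foreignFacePeriod_upToTwistAndSquare`.

So re-typing the stage-2 crux from `PerLFace(U)` (`∀ ι₁ ∀ V`) to any of these `∃`-forms with the surface field equal to the face field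
changes NOTHING in strength on the universe of record; only the FOREIGN-surface forms (`FacePeriodsForeignSurface.lean`, surface field
`L ≠ F`) are possibly weaker.  This file creates no period and changes no row; theorems only (plus `example`s).  HC_CM is NOT proved.
-/

noncomputable section

open NumberField
open Literature.AlgebraicGeometry.Motives (CMType)
open Literature.AlgebraicGeometry.HodgeTheory
open Literature.NumberTheory.Automorphic.PicardCM
open Literature.NumberTheory.ComplexMultiplication.CMTypeOps
open Literature.NumberTheory.Automorphic.PicardCM.CMCode (cmTypeMap mem_cmTypeMap_iff)

namespace Summit.HodgeConjecture.CorCM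

/-! ### §0 Two field lemmas -/

/-- Over a Galois (normal) number field every complex embedding is a relabelling `ι₀ ∘ h⁻¹` of a fixed one (Shimura's indexing of the
embeddings by the Galois group; `Pohlmann1968.exists_algEquiv_comp_eq`), in the tower notation of `Model.periodNV_relabel`. [folklore] -/
theorem exists_ringEquiv_tower_eq {F : CMField} [IsGalois ℚ F] (ι₀ ι₁ : F →+* ℂ) :
    ∃ h : (F : Type) ≃+* F, ι₀.comp h.symm.toRingHom = ι₁ := by
  obtain ⟨γ, hγ⟩ := Literature.AlgebraicGeometry.Pohlmann1968.exists_algEquiv_comp_eq ι₀ ι₁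
  exact ⟨γ.toRingEquiv.symm, RingHom.ext fun x => by simpa using hγ x⟩

namespace Face

/-- The trivial twist is the identity: `f.twist 1 = f`. [folklore] -/
theorem twist_refl {K : Type} [Field K] (f : Face K) : f.twist (RingEquiv.refl K) = f := by
  obtain ⟨Φ, p, p', hne⟩ := f
  simp only [Face.twist, Face.mk.injEq]
  refine ⟨Subtype.ext (Set.ext fun σ => ?_), RingHom.ext fun x => rfl, RingHom.ext fun x => rfl⟩
  rw [mem_cmTypeMap_iff, RingEquiv.toRingHom_refl, RingHom.comp_id]

end Face

namespace Model

/-! ### §1 The collapse at one face -/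

/-- **THE QUANTIFIER COLLAPSE at one face (universe of record).**  For a Galois CM field `F` with `[F:ℚ] > 2` and a face `f`: ONE free
datum `U.PeriodNV ι₀ V₀ F f.psi σ` (any tower place `ι₀`, any hermitian space `V₀`, any eigen-embedding `σ`) gives `U.PeriodNV ι₁ V F f.psi ι₁`
for EVERY admissible `ι₁` and EVERY `V : HermSpace3 F ι₁` — row C (`σ ↦ ι₁`, which lies in all four period types), then row B along the
automorphism `γ` with `ι₁ = ι₀ ∘ γ` (which contains row A: all `V`). [folklore] -/
theorem periodNV_collapse (hHD : exists_isReal_hodgeModel) (hI : hodgePQ_independent_of_hodgeModel)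
    (h₁ : BallQuotientUniformised) (h₃ : CMAbelianVarietyRealised) {F : CMField} [IsGalois ℚ F] (hF : 2 < Module.finrank ℚ F) (f : Face F) {ι₀ : F →+* ℂ}
    {V₀ : HermSpace3 F ι₀} {σ : F →+* ℂ} (h : (picardCMUniverse hHD hI h₁ h₃).PeriodNV ι₀ V₀ F f.psi σ)
    (ι₁ : F →+* ℂ) (hι₁ : f.Admissible ι₁) (V : HermSpace3 F ι₁) :
    (picardCMUniverse hHD hI h₁ h₃).PeriodNV ι₁ V F f.psi ι₁ := by
  -- C: move the eigen-embedding to `ι₁`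
  have hC : (picardCMUniverse hHD hI h₁ h₃).PeriodNV ι₀ V₀ F f.psi ι₁ :=
    periodNV_of_periodNV_of_forall_mem hHD hI h₁ h₃ V₀ f.psi (admissible_mem_psi f ι₁ hι₁) h
  -- B ⊇ A: `ι₁ = ι₀ ∘ h⁻¹`, relabel the tower and spread over every hermitian space
  obtain ⟨e, rfl⟩ := exists_ringEquiv_tower_eq ι₀ ι₁
  exact periodNV_relabel hHD hI h₁ h₃ hF e V hC

/-- **Per face: the FREE `∃`-form ⇔ the `∀ ι₁ ∀ V`-form** (`[F:ℚ] ≥ 6`; `←` evaluates at an admissible place, `StubTree.admissible_exists`,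
and a hermitian space, `landherr_exists_proof`). [folklore] -/
theorem exists_facePeriod_free_iff_forall (hHD : exists_isReal_hodgeModel) (hI : hodgePQ_independent_of_hodgeModel)
    (h₁ : BallQuotientUniformised) (h₃ : CMAbelianVarietyRealised) {F : CMField} [IsGalois ℚ F] (h6 : 6 ≤ Module.finrank ℚ F) (f : Face F) :
    (∃ (ι₀ : F →+* ℂ) (V₀ : HermSpace3 F ι₀) (σ : F →+* ℂ), (picardCMUniverse hHD hI h₁ h₃).PeriodNV ι₀ V₀ F f.psi σ) ↔
      ∀ (ι₁ : F →+* ℂ), f.Admissible ι₁ → ∀ V : HermSpace3 F ι₁, (picardCMUniverse hHD hI h₁ h₃).PeriodNV ι₁ V F f.psi ι₁ := by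
  constructor
  · rintro ⟨ι₀, V₀, σ, h⟩ ι₁ hι₁ V
    exact periodNV_collapse hHD hI h₁ h₃ (by omega) f h ι₁ hι₁ V
  · intro h
    obtain ⟨ι₁, hι₁⟩ := StubTree.admissible_exists F h6 f
    obtain ⟨V⟩ := landherr_exists_proof F ι₁
    exact ⟨ι₁, V, ι₁, h ι₁ hι₁ V⟩

/-- **Per face: the ADMISSIBLE `∃`-form ⇔ the `∀ ι₁ ∀ V`-form** (`[F:ℚ] ≥ 6`). [folklore] -/
theorem exists_facePeriod_iff_forall (hHD : exists_isReal_hodgeModel) (hI : hodgePQ_independent_of_hodgeModel)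
    (h₁ : BallQuotientUniformised) (h₃ : CMAbelianVarietyRealised) {F : CMField} [IsGalois ℚ F] (h6 : 6 ≤ Module.finrank ℚ F) (f : Face F) :
    (∃ ι₀ : F →+* ℂ, f.Admissible ι₀ ∧ ∃ (V₀ : HermSpace3 F ι₀) (σ : F →+* ℂ),
        (picardCMUniverse hHD hI h₁ h₃).PeriodNV ι₀ V₀ F f.psi σ) ↔
      ∀ (ι₁ : F →+* ℂ), f.Admissible ι₁ → ∀ V : HermSpace3 F ι₁, (picardCMUniverse hHD hI h₁ h₃).PeriodNV ι₁ V F f.psi ι₁ := by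
  rw [← exists_facePeriod_free_iff_forall hHD hI h₁ h₃ h6 f]
  constructor
  · rintro ⟨ι₀, -, V₀, σ, h⟩
    exact ⟨ι₀, V₀, σ, h⟩
  · rintro ⟨ι₀, V₀, σ, h⟩
    obtain ⟨ι₁, hι₁⟩ := StubTree.admissible_exists F h6 f
    obtain ⟨V⟩ := landherr_exists_proof F ι₁
    exact ⟨ι₁, hι₁, V, ι₁, periodNV_collapse hHD hI h₁ h₃ (by omega) f h ι₁ hι₁ V⟩

/-! ### §2 `PerLFace(U)` ⇔ the `∃`-hypotheses of the closed displays -/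

/-- **`PerLFace(U)` ⇔ «FacePeriodExists»** — the LITERAL hypothesis of `hc_cm_closed_of_exists_facePeriod` (`FacePeriodWitnesses.lean`:189):
one non-zero period per face of every Galois CM field of degree `≥ 6`, at some admissible place, on some hermitian space, with eigenforms at
some embedding.  The converse direction left open in `FacePeriodWitnesses.lean` is the collapse of §1. [folklore] -/
theorem perLFace_iff_exists_facePeriod (hHD : exists_isReal_hodgeModel) (hI : hodgePQ_independent_of_hodgeModel)
    (h₁ : BallQuotientUniformised) (h₃ : CMAbelianVarietyRealised) :
    (picardCMUniverse hHD hI h₁ h₃).PerLFace ↔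
      ∀ (F : CMField), IsGalois ℚ F → 6 ≤ Module.finrank ℚ F → ∀ f : Face F,
        ∃ ι₁ : F →+* ℂ, f.Admissible ι₁ ∧ ∃ (V : HermSpace3 F ι₁) (σ : F →+* ℂ),
          (picardCMUniverse hHD hI h₁ h₃).PeriodNV ι₁ V F f.psi σ := by
  constructor
  · intro hP F hG h6 f
    haveI := hG
    exact (exists_facePeriod_iff_forall hHD hI h₁ h₃ h6 f).2 (hP F hG h6 f)
  · intro h F hG h6 f
    haveI := hG
    exact (exists_facePeriod_iff_forall hHD hI h₁ h₃ h6 f).1 (h F hG h6 f)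

/-- **`PerLFace(U)` ⇔ the FREE form** — the literal hypothesis of `hc_cm_closed_of_exists_facePeriod_free`
(`B01/Transposition/AssemblyFree.lean`:191): per face, a non-zero period on SOME compact Picard modular surface over `F` at ANY place, with
eigenforms at ANY embedding. [folklore] -/
theorem perLFace_iff_exists_facePeriod_free (hHD : exists_isReal_hodgeModel) (hI : hodgePQ_independent_of_hodgeModel)
    (h₁ : BallQuotientUniformised) (h₃ : CMAbelianVarietyRealised) :
    (picardCMUniverse hHD hI h₁ h₃).PerLFace ↔
      ∀ (F : CMField), IsGalois ℚ F → 6 ≤ Module.finrank ℚ F → ∀ f : Face F,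
        ∃ (ι₁ : F →+* ℂ) (V : HermSpace3 F ι₁) (σ : F →+* ℂ), (picardCMUniverse hHD hI h₁ h₃).PeriodNV ι₁ V F f.psi σ := by
  constructor
  · intro hP F hG h6 f
    haveI := hG
    exact (exists_facePeriod_free_iff_forall hHD hI h₁ h₃ h6 f).2 (hP F hG h6 f)
  · intro h F hG h6 f
    haveI := hG
    exact (exists_facePeriod_free_iff_forall hHD hI h₁ h₃ h6 f).1 (h F hG h6 f)

/-! ### §3 Up to Galois twists and square symmetries -/

/-- **One free datum per (twist × square)-class gives everything in the class.**  If `f` lies in the type square of the twist `f₀.twist g`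
(same unordered pair of places, base type one of the four corners) and `f₀` has ONE free datum `U.PeriodNV ι₀ V₀ F f₀.psi σ`, then
`U.PeriodNV ι₁ V F f.psi ι₁` for every admissible `ι₁` and every `V` (`[F:ℚ] ≥ 6`): row C to an admissible place of `f₀`, row T (twist on the
same surface, `Model.periodNV_twist` / `Face.twist_psi`), b07's `Model.periodNV_iff_of_sameSquare`, then §1. [folklore] -/
theorem periodNV_of_sameSquare_twist (hHD : exists_isReal_hodgeModel) (hI : hodgePQ_independent_of_hodgeModel)
    (h₁ : BallQuotientUniformised) (h₃ : CMAbelianVarietyRealised) {F : CMField} [IsGalois ℚ F] (h6 : 6 ≤ Module.finrank ℚ F) {f₀ f : Face F}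
    (g : (F : Type) ≃+* F)
    (hpl : (InfinitePlace.mk f.p = InfinitePlace.mk (f₀.twist g).p ∧ InfinitePlace.mk f.p' = InfinitePlace.mk (f₀.twist g).p') ∨
      (InfinitePlace.mk f.p = InfinitePlace.mk (f₀.twist g).p' ∧ InfinitePlace.mk f.p' = InfinitePlace.mk (f₀.twist g).p))
    (hΦ : f.Φ = (f₀.twist g).Φ ∨ f.Φ = flip (f₀.twist g).p (f₀.twist g).Φ ∨ f.Φ = flip (f₀.twist g).p' (f₀.twist g).Φ ∨
      f.Φ = flip (f₀.twist g).p' (flip (f₀.twist g).p (f₀.twist g).Φ))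
    {ι₀ : F →+* ℂ} {V₀ : HermSpace3 F ι₀} {σ : F →+* ℂ} (h : (picardCMUniverse hHD hI h₁ h₃).PeriodNV ι₀ V₀ F f₀.psi σ)
    (ι₁ : F →+* ℂ) (hι₁ : f.Admissible ι₁) (V : HermSpace3 F ι₁) :
    (picardCMUniverse hHD hI h₁ h₃).PeriodNV ι₁ V F f.psi ι₁ := by
  -- C: move `σ` to an admissible place `ι` of `f₀`
  obtain ⟨ι, hι⟩ := StubTree.admissible_exists F h6 f₀
  have hmem := admissible_mem_psi f₀ ι hι
  -- T: twist targets and character on the same surface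
  have hT : (picardCMUniverse hHD hI h₁ h₃).PeriodNV ι₀ V₀ F (f₀.twist g).psi (ι.comp g.symm.toRingHom) := by
    rw [funext (Face.twist_psi g f₀)]
    exact periodNV_twist hHD hI h₁ h₃ g hmem (periodNV_of_periodNV_of_forall_mem hHD hI h₁ h₃ V₀ f₀.psi hmem h)
  -- square symmetry, then the collapse
  exact periodNV_collapse hHD hI h₁ h₃ (by omega) f ((periodNV_iff_of_sameSquare hHD hI h₁ h₃ hpl hΦ V₀ _).2 hT) ι₁ hι₁ V

/-- **`PerLFace(U)` ⇔ one free datum per (twist × square)-class of faces** — the SAME-FIELD case (`L = F`) of the hypothesis of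
`hc_cm_closed_of_exists_foreignFacePeriod_upToTwistAndSquare` (`FacePeriodsForeignOrbit.lean`): for every face `f` of every Galois CM field
`F` of degree `≥ 6` there are a face `f₀` and `g ∈ Aut F` with `f` in the type square of `f₀.twist g` and ONE free datum for `f₀`
(`→`: `f₀ = f`, `g = 1`, `Face.twist_refl`). [folklore] -/
theorem perLFace_iff_exists_facePeriod_upToTwistSquare (hHD : exists_isReal_hodgeModel) (hI : hodgePQ_independent_of_hodgeModel)
    (h₁ : BallQuotientUniformised) (h₃ : CMAbelianVarietyRealised) :
    (picardCMUniverse hHD hI h₁ h₃).PerLFace ↔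
      ∀ (F : CMField), IsGalois ℚ F → 6 ≤ Module.finrank ℚ F → ∀ f : Face F,
        ∃ (f₀ : Face F) (g : (F : Type) ≃+* F),
          ((InfinitePlace.mk f.p = InfinitePlace.mk (f₀.twist g).p ∧ InfinitePlace.mk f.p' = InfinitePlace.mk (f₀.twist g).p') ∨
            (InfinitePlace.mk f.p = InfinitePlace.mk (f₀.twist g).p' ∧ InfinitePlace.mk f.p' = InfinitePlace.mk (f₀.twist g).p)) ∧
          (f.Φ = (f₀.twist g).Φ ∨ f.Φ = flip (f₀.twist g).p (f₀.twist g).Φ ∨ f.Φ = flip (f₀.twist g).p' (f₀.twist g).Φ ∨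
            f.Φ = flip (f₀.twist g).p' (flip (f₀.twist g).p (f₀.twist g).Φ)) ∧
          ∃ (ι₀ : F →+* ℂ) (V₀ : HermSpace3 F ι₀) (σ : F →+* ℂ), (picardCMUniverse hHD hI h₁ h₃).PeriodNV ι₀ V₀ F f₀.psi σ := by
  rw [perLFace_iff_exists_facePeriod_free hHD hI h₁ h₃]
  constructor
  · intro h F hG h6 f
    refine ⟨f, RingEquiv.refl F, ?_, ?_, h F hG h6 f⟩
    · rw [Face.twist_refl]
      exact Or.inl ⟨rfl, rfl⟩
    · rw [Face.twist_refl]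
      exact Or.inl rfl
  · intro h F hG h6 f
    haveI := hG
    obtain ⟨f₀, g, hpl, hΦ, ι₀, V₀, σ, h0⟩ := h F hG h6 f
    obtain ⟨ι₁, hι₁⟩ := StubTree.admissible_exists F h6 f
    obtain ⟨V⟩ := landherr_exists_proof F ι₁
    exact ⟨ι₁, V, ι₁, periodNV_of_sameSquare_twist hHD hI h₁ h₃ h6 g hpl hΦ h0 ι₁ hι₁ V⟩

end Model

/-! ### §4 Consistency checks at the four tree theorems (`example`s, no new constants) -/

/- The hypothesis of `hc_cm_closed_of_exists_facePeriod` (:189) IS `PerLFace` of the universe of record … -/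
example
    (h : ∀ (F : CMField), IsGalois ℚ F → 6 ≤ Module.finrank ℚ F → ∀ f : Face F,
      ∃ ι₁ : F →+* ℂ, f.Admissible ι₁ ∧ ∃ (V : HermSpace3 F ι₁) (σ : F →+* ℂ),
        (Model.picardCMUniverse exists_isReal_hodgeModel_holds hodgePQ_independent_of_hodgeModel_holds
          BallQuotient.ballQuotientUniformised_holds cmAbelianVarietyRealised_holds).PeriodNV ι₁ V F f.psi σ) :
    (Model.picardCMUniverse exists_isReal_hodgeModel_holds hodgePQ_independent_of_hodgeModel_holds
      BallQuotient.ballQuotientUniformised_holds cmAbelianVarietyRealised_holds).PerLFace :=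
  (Model.perLFace_iff_exists_facePeriod _ _ _ _).2 h

/- … and display F3 factors through :189 in both directions. -/
example
    (hP : (Model.picardCMUniverse exists_isReal_hodgeModel_holds hodgePQ_independent_of_hodgeModel_holds
      BallQuotient.ballQuotientUniformised_holds cmAbelianVarietyRealised_holds).PerLFace) : HC_CM :=
  hc_cm_closed_of_exists_facePeriod ((Model.perLFace_iff_exists_facePeriod _ _ _ _).1 hP)

end Summit.HodgeConjecture.CorCM

end
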